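import Literature.NumberTheory.EllipticCurves.KodairaNeronProofs
import Literature.NumberTheory.EllipticCurves.KodairaNeronLeFourProofs
import Literature.NumberTheory.EllipticCurves.KodairaNeronSplitCyclicProofs
import Literature.NumberTheory.EllipticCurves.TamagawaSubgroupProofs
import Literature.NumberTheory.EllipticCurves.ReductionHomomorphismCuspNodeProofs
import Literature.NumberTheory.EllipticCurves.VariableChangePoints
import Literature.NumberTheory.EllipticCurves.GeomPointReduction
import Literature.NumberTheory.EllipticCurves.PAdicHeights
import Literature.NumberTheory.EllipticCurves.MazurTorsion
import HarnessLib

/-!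
# Mazur 1977, Ch. III §5, Steps 1–2 of the prime case, proved: semistability away from `N`,
# split multiplicative reduction at `2` and `3` off the identity component, `N ∣ c_q = ord_q(Δ_min)`

Topic `Literature/NumberTheory/EllipticCurves`. Fourth sibling proof file (theorems only, no
definitions, no named facts, no `sorry`) of the vocabulary file `MazurTorsion.lean`, next to
`MazurTorsionProofs.lean`, `MazurTorsionReductionProofs.lean` and `MazurTorsionStepTwoProofs.lean`,
serving the prime-case leaf

* `Literature.NumberTheory.EllipticCurves.Mazur1977_no_prime_torsion W` — B. Mazur, *Modular
  curves and the Eisenstein ideal*, Publ. Math. IHÉS 47 (1977), Ch. III §5, pp. 156–160: for an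
  elliptic curve `E/ℚ` and a prime `N ∉ {2, 3, 5, 7, 13}`, no point of `E(ℚ)` has order `N`.

That leaf is Mazur's theorem itself (three reductions, then Steps 1–4; the heart, Step 3, needs
`X₀(N)` over `ℤ[1/2N]`, the Eisenstein quotient `J̃` and Thm. III.(4.1)) and stays far out of
reach. This file PROVES, in the printed strength and in the now available vocabulary of the tree
(reduction of points `E₀(K) → Ẽ_ns(k)`, `ReductionHomomorphism.lean`; the Kodaira–Néron theorem,
`KodairaNeron*.lean`, all discharged), the two LOCAL steps of the printed proof for the putative
curve "`ℤ/N ⊂ E`" (p. 157: `E/ℚ` with a rational point `P` of prime order `N`):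

* **Step 1 (p. 158), the primes `q ≠ N`: `E` is semistable at `q`.** Print: at a prime `q` of
  additive reduction "the index of `(E_{/𝔽_q})⁰` in `E_{/𝔽_q}` is `2^a 3^b` … It follows that
  the specialization `ℤ/N_{/𝔽_q}` must be contained in `(E_{/𝔽_q})⁰`. Consequently, `q = N`."
  Here: over any discrete valuation ring `R` with perfect residue field `k`, a minimal equation
  with ADDITIVE reduction has no `K`-point `P ≠ O` with `N • P = O`, `N ≥ 5` prime, `N ≠ 0` in
  `k` (`eq_zero_of_hasAdditiveReduction_of_prime_nsmul_eq_zero`): the index `[E(K) : E₀(K)]` is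
  `≤ 4` (Kodaira–Néron, tree `index_goodReductionSubgroup_le_four_holds`), so `P ∈ E₀(K)`, and
  `E₀(K)/E₁(K) ↪ Ẽ_ns(k̄) ≅ k̄⁺` (tree `exists_addMonoidHom_residueField_of_cusp`) with `E₁(K)`
  free of `N`-torsion (*AEC* VII.3.1(a): tree `v_le_one_of_zsmul_eq_zero` of `GeomPointReduction.lean`,
  by division polynomials, for any value group; here `not_reducesToZero_of_zsmul_eq_zero`). For `E/ℚ`: `Mazur1977_stepOne_padic` (no additive
  reduction at any `q ≠ N` once `N ≥ 5`), `Mazur1977_stepOne` (leaf scope). The case `q = N` of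
  Step 1 (Serre–Tate [72] and Raynaud [55]) is NOT treated.
* **Step 2 (pp. 158–159): "If `q = 2`, or `3`, then `E` has bad (hence multiplicative) reduction
  at `q`, and the specialization `ℤ/N_{/𝔽_q}` is not contained in the connected component of
  the identity `(E_{/𝔽_q})⁰`."** Dictionary (Silverman, *ATAEC* IV.9, Cor. 9.1, 9.2(b)): the
  points of `E(ℚ_q)` reducing into the identity component of the Néron model are the subgroup
  `E₀(ℚ_q)` of points with nonsingular reduction on a minimal equation (tree:
  `WeierstrassCurve.goodReductionSubgroup`), so the assertion is `P ∉ E₀(ℚ_q)`. Here: over a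
  discrete valuation ring with residue field of `q` elements, a point `P ∈ E₀(K)` of order `N`
  prime to `q` has `N ≤ #Ẽ_ns(k) ≤ 2q + 1` (`addOrderOf_le_of_mem_goodReductionSubgroup`:
  `⟨P⟩ ↪ Ẽ_ns(k)` by *AEC* VII.2.1/VII.3.1; Mazur bounds `#Ẽ_ns` by Hasse, resp. by
  `#𝔾_m(𝔽_{q²}) = q² - 1`; the trivial count suffices for `q = 2, 3`, `N ≥ 11`), hence for
  `2q + 1 < N`: `P ∉ E₀(K)`, the reduction is SPLIT multiplicative and `N ∣ [E(K) : E₀(K)]`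
  (`Mazur1977_stepTwo_local`; the class of `P` in `E(K)/E₀(K)` has order `N > 4`, and
  Kodaira–Néron again), and over a henselian ring `N ∣ c = v(Δ_min)`
  (`dvd_index_and_valuation_Δ_of_not_mem_goodReductionSubgroup`, Kodaira–Néron for split
  multiplicative reduction, tree `index_goodReductionSubgroup_of_hasSplitMultiplicativeReduction_holds`).
  For `E/ℚ`: `Mazur1977_stepTwo_padic` (any prime `q` with `2q + 1 < N`) and `Mazur1977_stepTwo`
  (`q ∈ {2, 3}`, `N` prime `∉ {2, 3, 5, 7, 13}`): the transported point is off `E₀(ℚ_q)`,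
  `W.HasSplitMultiplicativeReductionAtPrime q`, `N ∣ c_q(E)` (`localTamagawaNumber`) and
  `v_q(Δ_min) = exp(-c_q)`.

Consequences recorded for the leaf (PROVED special cases of `Mazur1977_no_prime_torsion W`):
every elliptic curve over `ℚ` which is not split multiplicative at `2` or at `3` — e.g. of odd
conductor, or additive at `2` — (`Mazur1977_no_prime_torsion_of_not_hasSplitMultiplicativeReductionAtPrime`),
and more generally every curve with `c₂(E) < 11` or `c₃(E) < 11`
(`Mazur1977_no_prime_torsion_of_localTamagawaNumber_lt`), has no rational point of prime order
`N ∉ {2, 3, 5, 7, 13}`. What the leaf still needs beyond this file is exactly the global part of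
the printed proof: Step 3 (`x = j(E, ℤ/N) ∈ X₀(N)(ℤ[1/2N])` meets the cusp `∞` at `2` and `3` but
would meet `0` at a bad `q` with `ℤ/N ⊂ (E_{/𝔽_q})⁰`; injectivity of `J̃(T) → J̃(𝔽_ℓ)` and
`0 ≠ ∞` in `J̃`), Step 4 and the three reductions (Shafarevich/Thm. (4.1), Herbrand).

## References

* [Mazur1977] B. Mazur, *Modular curves and the Eisenstein ideal*, Publ. Math. IHÉS 47 (1977),
  33–186: Ch. III §5, pp. 156–160, Steps 1–2 on pp. 158–159 (held:
  `paper:doi-10-1007-bf02684339`, PDF pp. 127–128; read).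
* [SilvermanATAEC1994] J. H. Silverman, *Advanced Topics in the Arithmetic of Elliptic Curves*,
  GTM 151, Springer 1994: IV.9, Cor. 9.1, Cor. 9.2(b),(d), Remarks 9.2.1–9.2.2 (PDF p. 340).
* [SilvermanAEC2009] J. H. Silverman, *The Arithmetic of Elliptic Curves*, 2nd ed., GTM 106,
  Springer 2009: VII.2 Prop. 2.1, VII.3 Prop. 3.1, VII.5 Prop. 5.1, Exercise 3.7 (PDF pp. 167–171,
  180).

## Tree inputs (all proved)

`WeierstrassCurve.index_goodReductionSubgroup_ne_zero_holds`, `…_le_four_holds`,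
`…_of_hasSplitMultiplicativeReduction_holds` (Kodaira–Néron; `KodairaNeronProofs`,
`KodairaNeronLeFourProofs`, `KodairaNeronSplitCyclicProofs`); `WeierstrassCurve.reductionHom`,
`reducePoint_eq_zero_iff`, `exists_addMonoidHom_residueField_of_cusp` (`ReductionHomomorphism`,
`ReductionHomomorphismCuspNodeProofs`); `v_le_one_of_zsmul_eq_zero` (`GeomPointReduction`);
`WeierstrassCurve.goodReductionSubgroup_baseChange_eq`
(`TamagawaSubgroupProofs`); `WeierstrassCurve.zsmul_some_eq_zero_iff_eval_ΨSq`
(`TorsionCardinality`); `VariableChange.pointEquiv` (`VariableChangePoints`);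
`WeierstrassCurve.finite_point` (`FrobeniusEndomorphism`: `E(k)` is finite for finite `k`);
Mathlib's `Affine.Point.map`, `WeierstrassCurve.minimal`, `HasAdditiveReduction`,
`HasSplitMultiplicativeReduction`, `PadicInt.residueField`.

## Design

No definitions; `noncomputable section`, `open scoped Classical` as in all the reduction files
(so that `E₀`, the quotient `E(K)/E₀(K)` and `addOrderOf` are elaborated against the same
instances as in `Tamagawa.lean`/`KodairaNeron.lean`; over `ℚ` the decidable equality of `ℚ` is
Mathlib's, as in the leaf). The transported point of §5 is written out
(`VariableChange.pointEquiv _ C (Affine.Point.map (Algebra.ofId ℚ ℚ_q) P)` on Mathlib's chosen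
minimal model `C • (W ⊗ ℚ_q) = (W ⊗ ℚ_q).minimal ℤ_q`, `rfl`) rather than named, to keep the
file definition-free.
-/

noncomputable section

open scoped Classical

namespace Literature.NumberTheory.EllipticCurves

open _root_.WeierstrassCurve _root_.Polynomial

/-! ## §1 Prime-to-`p` torsion is integral, hence not in `E₁(K)` (any valuation ring, any value group) -/

section Integrality

variable {K : Type*} [Field K] {Γ₀ : Type*} [LinearOrderedCommGroupWithZero Γ₀]
  {v : Valuation K Γ₀} {R : Type*} [CommRing R] [Algebra R K] {W : WeierstrassCurve R}

/-- **Torsion of order prime to the residue characteristic is integral** (Silverman, *AEC*,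
Prop. VII.3.1(a)), in the form needed here: for an equation `W` with coefficients in a valuation
ring `R` of `K` (any value group, `hv : v.Integers R`) and an affine point `P = (x, y)` of `W(K)`
with `n • P = O` and `v n = 1`, the abscissa `x` lies in `R`. This is the tree's
`v_le_one_of_zsmul_eq_zero` (`GeomPointReduction.lean`, by division polynomials: `ΨSqₙ(x) = 0`
while `ΨSqₙ ∈ R[X]` has unit top coefficient `n²`) followed by `hv.exists_of_le_one`.
[cite: SilvermanAEC2009, VII.3 Prop. 3.1(a) (PDF p. 170)] -/
theorem mem_range_X_of_zsmul_eq_zero (hv : v.Integers R) {n : ℤ} (hn : v (n : K) = 1) {x y : K}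
    {h : (W.baseChange K).toAffine.Nonsingular x y}
    (h0 : n • (Affine.Point.some x y h : (W.baseChange K).toAffine.Point) = 0) :
    x ∈ Set.range (algebraMap R K) :=
  let ⟨a, ha⟩ := hv.exists_of_le_one (v_le_one_of_zsmul_eq_zero hv hn h0)
  ⟨a, ha⟩

/-- **`E₁(K)` has no prime-to-`p` torsion** (Silverman, *AEC*, Prop. VII.3.1(a)), in the
language of `ReductionHomomorphism.lean`: a non-zero point `P` with `n • P = O`, `v n = 1`, does
not reduce to `O`. [cite: SilvermanAEC2009, VII.3 Prop. 3.1(a) (PDF p. 170)] -/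
theorem not_reducesToZero_of_zsmul_eq_zero (hv : v.Integers R) {n : ℤ} (hn : v (n : K) = 1)
    {P : (W.baseChange K).toAffine.Point} (hP : n • P = 0) (hP0 : P ≠ 0) :
    ¬ W.ReducesToZero P := by
  rcases P with _ | ⟨x, y, h⟩
  · exact (hP0 rfl).elim
  · rw [_root_.WeierstrassCurve.reducesToZero_some_iff, not_not]
    exact mem_range_X_of_zsmul_eq_zero hv hn hP

/-! ## §2 A torsion point of `E₀(K)` of order `N` prime to `p` forces `N ≤ #Ẽ_ns(k)` -/

/-- **Reduction embeds the prime-to-`p` torsion of `E₀(K)` into `Ẽ_ns(k)`** (Silverman, *AEC*,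
Prop. VII.2.1 with VII.3.1: the reduction homomorphism `E₀(K) → Ẽ_ns(k)` has kernel `E₁(K)`, which
has no `n`-torsion for `v n = 1`; *ATAEC* IV.9 Remark 9.2.2), in the form used by Mazur: if
`P ∈ E₀(K)` satisfies `n • P = O` with `v n = 1`, then the cyclic group `⟨P⟩` injects into the
finite group `Ẽ_ns(k)` of nonsingular points of the reduced cubic, so the order of `P` is at
most `#Ẽ_ns(k)`. [cite: SilvermanAEC2009, VII.2 Prop. 2.1 and VII.3 Prop. 3.1 (PDF pp. 167–171)] -/
theorem addOrderOf_le_natCard_of_hasNonsingularReduction [IsLocalRing R] (hv : v.Integers R)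
    [Finite (W.map (IsLocalRing.residue R)).toAffine.Point]
    {P : (W.baseChange K).toAffine.Point} (hP : W.HasNonsingularReduction P)
    {n : ℤ} (hn : v (n : K) = 1) (hnP : n • P = 0) :
    addOrderOf P ≤ Nat.card (W.map (IsLocalRing.residue R)).toAffine.Point := by
  have hle : AddSubgroup.zmultiples P ≤ W.nonsingularReductionSubgroup hv :=
    AddSubgroup.zmultiples_le_of_mem hP
  set f : AddSubgroup.zmultiples P →+ (W.map (IsLocalRing.residue R)).toAffine.Point :=
    (W.reductionHom hv).comp (AddSubgroup.inclusion hle) with hf_def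
  have hf : Function.Injective f := by
    rw [injective_iff_map_eq_zero]
    rintro ⟨Q, hQ⟩ hfQ
    obtain ⟨m, rfl⟩ := AddSubgroup.mem_zmultiples_iff.mp hQ
    have hred : W.reducePoint (m • P) = 0 := hfQ
    have h0 : W.ReducesToZero (m • P) := (_root_.WeierstrassCurve.reducePoint_eq_zero_iff hv (hle hQ)).mp hred
    have hn' : n • (m • P) = 0 := by rw [← mul_zsmul, mul_comm, mul_zsmul, hnP, zsmul_zero]
    by_contra hne
    exact not_reducesToZero_of_zsmul_eq_zero hv hn hn' (fun h ↦ hne (Subtype.ext h)) h0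
  calc addOrderOf P
      = addOrderOf ((AddSubgroup.zmultiples P).subtype ⟨P, AddSubgroup.mem_zmultiples P⟩) := rfl
    _ = addOrderOf (⟨P, AddSubgroup.mem_zmultiples P⟩ : AddSubgroup.zmultiples P) :=
        addOrderOf_injective _ Subtype.coe_injective _
    _ = addOrderOf (f ⟨P, AddSubgroup.mem_zmultiples P⟩) := (addOrderOf_injective f hf _).symm
    _ ≤ Nat.card (W.map (IsLocalRing.residue R)).toAffine.Point := addOrderOf_le_card

end Integrality

/-! ## §3 The trivial count `#Ṽ(k) ≤ 2q + 1` -/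

section Count

variable {k : Type*} [Field k] [Fintype k] (V : WeierstrassCurve k)

/-- For fixed `x` a Weierstrass equation is a monic quadratic in `y`: at most two solutions.
(As `WeierstrassCurve.card_filter_equation_le_two` of the analytic file
`AnalyticRankLSeriesSummableProofs`, reproved to keep the imports of this file arithmetic.)
[folklore] -/
theorem card_filter_equation_le_two' (x : k) :
    (Finset.univ.filter fun y : k ↦ V.toAffine.Equation x y).card ≤ 2 := by
  by_contra h
  push Not at h
  obtain ⟨y₁, hy₁, y₂, hy₂, y₃, hy₃, h12, h13, h23⟩ := Finset.two_lt_card.mp h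
  simp only [Finset.mem_filter, Finset.mem_univ, true_and, Affine.equation_iff'] at hy₁ hy₂ hy₃
  have e12 : (y₁ - y₂) * (y₁ + y₂ + V.toAffine.a₁ * x + V.toAffine.a₃) = 0 := by
    linear_combination hy₁ - hy₂
  have e13 : (y₁ - y₃) * (y₁ + y₃ + V.toAffine.a₁ * x + V.toAffine.a₃) = 0 := by
    linear_combination hy₁ - hy₃
  rcases mul_eq_zero.mp e12 with h | h
  · exact h12 (sub_eq_zero.mp h)
  rcases mul_eq_zero.mp e13 with h' | h'
  · exact h13 (sub_eq_zero.mp h')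
  exact h23 (by linear_combination h - h')

/-- A Weierstrass equation over a field with `q` elements has at most `2q` affine solutions.
(As `WeierstrassCurve.card_filter_equation_le` of `AnalyticRankLSeriesSummableProofs`.)
[folklore] -/
theorem card_filter_equation_le' :
    (Finset.univ.filter fun xy : k × k ↦ V.toAffine.Equation xy.1 xy.2).card ≤
      2 * Fintype.card k := by
  set s := Finset.univ.filter fun xy : k × k ↦ V.toAffine.Equation xy.1 xy.2 with hs
  calc s.card ≤ 2 * (s.image Prod.fst).card := by
        refine Finset.card_le_mul_card_image s 2 fun x _ ↦ ?_
        calc (s.filter fun xy ↦ xy.1 = x).card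
            ≤ (Finset.univ.filter fun y : k ↦ V.toAffine.Equation x y).card := by
              refine Finset.card_le_card_of_injOn Prod.snd (fun xy hxy ↦ ?_)
                (fun xy₁ h₁ xy₂ h₂ h ↦ ?_)
              · simp only [hs, Finset.coe_filter, Finset.mem_filter, Finset.mem_univ, true_and,
                  Set.mem_setOf_eq] at hxy ⊢
                obtain ⟨heq, rfl⟩ := hxy
                exact heq
              · simp only [hs, Finset.coe_filter, Finset.mem_filter, Finset.mem_univ, true_and,
                  Set.mem_setOf_eq] at h₁ h₂
                exact Prod.ext (h₁.2.trans h₂.2.symm) h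
          _ ≤ 2 := card_filter_equation_le_two' V x
    _ ≤ 2 * Fintype.card k := by
        gcongr
        exact Finset.card_le_univ _

/-- **Trivial bound for the number of nonsingular points** of a (possibly singular) Weierstrass
cubic over a field with `q` elements: `#Ṽ(𝔽_q) ≤ 2q + 1` (two ordinates per abscissa at most,
plus `O`). For `q = 2, 3` this is `5, 7`, which is all that Mazur's Step 2 needs for `N ≥ 11`
(Mazur quotes Hasse's `1 + q + 2√q` for an elliptic reduction and `#𝔾_m(𝔽_{q²}) = q² - 1` for a
multiplicative one). (Same statement as `WeierstrassCurve.natCard_point_le_two_mul_card_add_one`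
of the analytic file `AnalyticRankLSeriesSummableProofs`, reproved here to keep the imports
arithmetic.) [folklore] -/
theorem natCard_point_le_two_mul_card_add_one' :
    Nat.card V.toAffine.Point ≤ 2 * Fintype.card k + 1 := by
  set E : Finset (k × k) := Finset.univ.filter fun xy : k × k ↦ V.toAffine.Equation xy.1 xy.2
    with hE
  have e : V.toAffine.Point ≃ Option {xy : k × k // V.toAffine.Nonsingular xy.1 xy.2} :=
    Affine.nonsingularPointEquiv V.toAffine
  set ι : {xy : k × k // V.toAffine.Nonsingular xy.1 xy.2} → {xy // xy ∈ E} :=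
    fun p ↦ ⟨p.1, by simpa [hE] using p.2.1⟩ with hι
  have hinj : Function.Injective ι := fun p₁ p₂ h ↦
    Subtype.ext (by simpa [hι] using congrArg Subtype.val h)
  calc Nat.card V.toAffine.Point
      = Nat.card {xy : k × k // V.toAffine.Nonsingular xy.1 xy.2} + 1 := by
        rw [Nat.card_congr e, Nat.card_eq_fintype_card (α := Option _), Fintype.card_option,
          ← Nat.card_eq_fintype_card]
    _ ≤ Nat.card {xy // xy ∈ E} + 1 := by
        gcongr
        exact Nat.card_le_card_of_injective ι hinj
    _ = E.card + 1 := by rw [Nat.card_eq_finsetCard]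
    _ ≤ 2 * Fintype.card k + 1 := by
        gcongr
        exact card_filter_equation_le' V

end Count

/-! ## §4 Over a discrete valuation ring: Kodaira–Néron and the index argument -/

section DVR

variable (R : Type*) [CommRing R] [IsDomain R] [IsDiscreteValuationRing R] {K : Type*}
  [Field K] [Algebra R K] [IsFractionRing R K] (W : WeierstrassCurve K)

/-- In a finite field with fewer than `N` elements a prime `N` is non-zero (the characteristic
`p` satisfies `p ≤ #k < N`). [folklore] -/
theorem natCast_ne_zero_of_card_lt {k : Type*} [Field k] [Finite k] {N : ℕ} (hN : N.Prime)
    (hk : Nat.card k < N) : (N : k) ≠ 0 := by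
  intro h0
  obtain ⟨p, hp⟩ := CharP.exists k
  have hpN : p ∣ N := (CharP.cast_eq_zero_iff k p N).mp h0
  haveI := Fintype.ofFinite k
  have hprime : p.Prime := (CharP.char_is_prime_or_zero k p).resolve_right (by
    rintro rfl
    haveI : CharZero k := CharP.charP_to_charZero k
    exact (Infinite.of_injective _ Nat.cast_injective).not_finite ‹Finite k›)
  have hpeq : p = N := (Nat.prime_dvd_prime_iff_eq hprime hN).mp hpN
  obtain ⟨n, -, hcard⟩ := FiniteField.card k p
  have hle : p ≤ Fintype.card k := by
    rw [hcard]
    exact Nat.le_self_pow n.ne_zero p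
  rw [Nat.card_eq_fintype_card] at hk
  omega

/-- **Mazur 1977, Ch. III §5, Step 2, "`ℤ/N_{/𝔽_q} ⊄ (E_{/𝔽_q})⁰`", over a discrete valuation
ring** (p. 159: "If `E_{/𝔽_q}` were an elliptic curve, and `ℤ/N ⊂ E_{/𝔽_q}`, then by the
'Riemann hypothesis' `N < 1 + q + 2√q` … `(E_{/𝔽_q})⁰` is isomorphic to `𝔾_m` … which has
`q² - 1` points. Again we cannot have `ℤ/N ⊂ 𝔾_{m/𝔽_q}`"). Dictionary: for the Néron model `E`
of an elliptic curve over the fraction field `K` of a discrete valuation ring `R` with residue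
field `k`, the points of `E(K) = E(R)` reducing into the identity component `(E_{/k})⁰` are
exactly the subgroup `E₀(K)` of points with nonsingular reduction on a minimal Weierstrass
equation, and `(E_{/k})⁰ ≅ Ẽ_ns` (Silverman, *ATAEC* IV.9, Cor. 9.1 and Cor. 9.2(b)); so
"`ℤ/N_{/k} ⊂ (E_{/k})⁰`" for the constant group generated by a `K`-point `P` of order `N` means
`P ∈ E₀(K)`. **Statement.** `R` a discrete valuation ring with finite residue field `k`, `W` an
`R`-minimal Weierstrass equation over `K`, `P ∈ E₀(K)` with `n • P = O` for an integer `n`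
which is non-zero in `k`: then the order of `P` is at most `#Ẽ_ns(k) ≤ 2·#k + 1`. Proof:
reduction `E₀(K) → Ẽ_ns(k)` is a homomorphism with kernel `E₁(K)` (*AEC* VII.2.1, tree
`WeierstrassCurve.reductionHom`), `E₁(K)` has no `n`-torsion (*AEC* VII.3.1(a), here
`not_reducesToZero_of_zsmul_eq_zero`), so `⟨P⟩ ↪ Ẽ_ns(k)`, whose order is bounded trivially
(`natCard_point_le_two_mul_card_add_one'`; Mazur uses Hasse, resp. `#𝔾_m(𝔽_{q²})`, instead).
[cite: Mazur1977, Ch. III §5, Step 2, p. 159; SilvermanATAEC1994, IV.9 Cor. 9.1, Cor. 9.2(b), Remark 9.2.2 (PDF p. 340); SilvermanAEC2009, VII.2 Prop. 2.1, VII.3 Prop. 3.1] -/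
theorem addOrderOf_le_of_mem_goodReductionSubgroup [W.IsMinimal R]
    [Finite (IsLocalRing.ResidueField R)] {P : W.toAffine.Point}
    (hP : P ∈ W.goodReductionSubgroup R) {n : ℤ} (hn : (n : IsLocalRing.ResidueField R) ≠ 0)
    (hnP : n • P = 0) :
    addOrderOf P ≤ 2 * Nat.card (IsLocalRing.ResidueField R) + 1 := by
  obtain ⟨W₀, rfl⟩ : ∃ W₀ : WeierstrassCurve R, W = W₀.baseChange K := IsIntegral.integral
  have hv := integers_valuationRing_valuation R K
  rw [goodReductionSubgroup_baseChange_eq, mem_nonsingularReductionSubgroup_iff] at hP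
  haveI := Fintype.ofFinite (IsLocalRing.ResidueField R)
  haveI : Finite (W₀.map (IsLocalRing.residue R)).toAffine.Point := finite_point _
  have hn' : ValuationRing.valuation R K (n : K) = 1 := by
    rw [show (n : K) = algebraMap R K (n : R) by simp, v_algebraMap_eq_one_iff hv]
    simpa using hn
  calc addOrderOf P ≤ Nat.card (W₀.map (IsLocalRing.residue R)).toAffine.Point :=
        addOrderOf_le_natCard_of_hasNonsingularReduction hv hP hn' hnP
    _ ≤ 2 * Fintype.card (IsLocalRing.ResidueField R) + 1 :=
        natCard_point_le_two_mul_card_add_one' _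
    _ = 2 * Nat.card (IsLocalRing.ResidueField R) + 1 := by rw [Nat.card_eq_fintype_card]

/-- **Mazur 1977, Ch. III §5, Step 1 at a prime `q ≠ N`, as an index argument; with the
component corollary** (p. 158: "Let `q` be a (rational) prime of nonsemi-stable (i.e. additive)
reduction for `E`. Thus the connected component of the fibre `(E_{/𝔽_q})⁰` is an additive group,
and, as is well known, the index of `(E_{/𝔽_q})⁰` in `E_{/𝔽_q}` is `2^a 3^b` for suitable
integers `a, b`. It follows that the specialization `ℤ/N_{/𝔽_q}` must be contained in
`(E_{/𝔽_q})⁰`"). In the dictionary of `addOrderOf_le_of_mem_goodReductionSubgroup`, and with the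
"well known" index bound supplied by the Kodaira–Néron theorem (Silverman, *ATAEC* Cor. IV.9.2(d):
`[E(K) : E₀(K)] ≤ 4` unless the reduction is split multiplicative — PROVED in the tree,
`WeierstrassCurve.index_goodReductionSubgroup_le_four_holds`, together with the finiteness
`index_goodReductionSubgroup_ne_zero_holds`): let `R` be a discrete valuation ring with perfect
residue field, `W` an `R`-minimal equation of an elliptic curve over `K`, and `P ∈ E(K)` a point
with `N • P = O` for a prime `N ≥ 5` which does NOT lie in `E₀(K)`. Then the class of `P` in the
finite group `E(K)/E₀(K)` has order exactly `N`, so `N ∣ [E(K) : E₀(K)]`; as `N > 4`, the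
reduction is **split multiplicative**. (Contrapositive of Mazur's sentence: additive — indeed any
non-split-multiplicative — reduction forces `P ∈ E₀(K)`.)
[cite: Mazur1977, Ch. III §5, Step 1, p. 158; SilvermanATAEC1994, Cor. IV.9.2(d) (PDF p. 340)] -/
theorem hasSplitMultiplicativeReduction_of_not_mem_goodReductionSubgroup
    [PerfectField (IsLocalRing.ResidueField R)] [W.IsElliptic] [W.IsMinimal R]
    {N : ℕ} (hN : N.Prime) (h5 : 5 ≤ N) {P : W.toAffine.Point} (hNP : N • P = 0)
    (hP : P ∉ W.goodReductionSubgroup R) :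
    W.HasSplitMultiplicativeReduction R ∧ N ∣ (W.goodReductionSubgroup R).index := by
  have hne : (W.goodReductionSubgroup R).index ≠ 0 := W.index_goodReductionSubgroup_ne_zero_holds R
  have hdvd : N ∣ (W.goodReductionSubgroup R).index := by
    have hcl0 : (QuotientAddGroup.mk P : W.toAffine.Point ⧸ W.goodReductionSubgroup R) ≠ 0 := by
      rwa [Ne, QuotientAddGroup.eq_zero_iff]
    have hclN : N • (QuotientAddGroup.mk P : W.toAffine.Point ⧸ W.goodReductionSubgroup R) = 0 := by
      rw [← QuotientAddGroup.mk_nsmul, hNP, QuotientAddGroup.mk_zero]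
    have hord : addOrderOf (QuotientAddGroup.mk P : W.toAffine.Point ⧸ W.goodReductionSubgroup R)
        = N := by
      rcases (Nat.dvd_prime hN).mp (addOrderOf_dvd_of_nsmul_eq_zero hclN) with h1 | h
      · exact absurd (AddMonoid.addOrderOf_eq_one_iff.mp h1) hcl0
      · exact h
    rw [AddSubgroup.index_eq_card, ← hord]
    exact addOrderOf_dvd_natCard _
  refine ⟨?_, hdvd⟩
  by_contra hns
  obtain ⟨-, h4⟩ := (W.index_goodReductionSubgroup_le_four_holds R) hns
  have hle : N ≤ (W.goodReductionSubgroup R).index := Nat.le_of_dvd (Nat.pos_of_ne_zero hne) hdvd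
  omega

/-- **Mazur 1977, Ch. III §5, Step 1 at a prime `q ≠ N`: additive reduction is impossible**
(p. 158: "Let `q` be a (rational) prime of nonsemi-stable (i.e. additive) reduction for `E`.
Thus the connected component of the fibre `(E_{/𝔽_q})⁰` is an additive group, and … the index
of `(E_{/𝔽_q})⁰` in `E_{/𝔽_q}` is `2^a 3^b` … It follows that the specialization `ℤ/N_{/𝔽_q}`
must be contained in `(E_{/𝔽_q})⁰`. Consequently, `q = N`"; the case `q = N` of Step 1 is the
Serre–Tate/Raynaud argument and is not treated here). Over a discrete valuation ring `R` with
perfect residue field `k`: if an `R`-minimal equation `W` of an elliptic curve over `K` has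
**additive** reduction and `P ∈ E(K)` satisfies `N • P = O` for a prime `N ≥ 5` which is
non-zero in `k` ("`q ≠ N`"), then `P = O`. Proof, following the print: by Kodaira–Néron the index
`[E(K) : E₀(K)]` is `≤ 4 < N` (`hasSplitMultiplicativeReduction_of_not_mem_goodReductionSubgroup`,
contrapositive), so `P ∈ E₀(K)`; the reduction is a cusp, and `E₀(K)/E₁(K) ↪ Ẽ_ns(k̄) ≅ k̄⁺`
(Silverman, *AEC* VII.2.1 with III.2.5, tree `WeierstrassCurve.exists_addMonoidHom_residueField_of_cusp`),
where `N` is invertible, so `P ∈ E₁(K)`, which has no `N`-torsion (*AEC* VII.3.1(a),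
`not_reducesToZero_of_zsmul_eq_zero`). In words: **an elliptic curve with a `K`-rational point of
prime order `N ≥ 5`, `N ∤ char k`, does not have additive reduction.**
[cite: Mazur1977, Ch. III §5, Step 1, p. 158; SilvermanATAEC1994, Cor. IV.9.2(d) and Remark 9.2.2 (PDF p. 340); SilvermanAEC2009, VII.2 Prop. 2.1, VII.3 Prop. 3.1(a)] -/
theorem eq_zero_of_hasAdditiveReduction_of_prime_nsmul_eq_zero
    [PerfectField (IsLocalRing.ResidueField R)] [W.IsElliptic] [hadd : W.HasAdditiveReduction R]
    {N : ℕ} (hN : N.Prime) (h5 : 5 ≤ N) (hNk : (N : IsLocalRing.ResidueField R) ≠ 0)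
    {P : W.toAffine.Point} (hNP : N • P = 0) : P = 0 := by
  -- (a) `P ∈ E₀(K)`: otherwise the reduction would be split multiplicative
  have hP₀ : P ∈ W.goodReductionSubgroup R := by
    by_contra hP
    exact HasAdditiveReduction.not_hasMultiplicativeReduction R hadd
      (hasSplitMultiplicativeReduction_of_not_mem_goodReductionSubgroup R W hN h5 hNP
        hP).1.toHasMultiplicativeReduction
  -- (b) write `W = W₀ ⊗ K`; the reduction of `W₀` is a cusp
  have hbad := hadd.badReduction
  have haddc := hadd.additiveReduction
  obtain ⟨W₀, rfl⟩ : ∃ W₀ : WeierstrassCurve R, W = W₀.baseChange K := IsIntegral.integral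
  have hv := integers_valuationRing_valuation R K
  rw [goodReductionSubgroup_baseChange_eq, mem_nonsingularReductionSubgroup_iff] at hP₀
  have hΔ : IsLocalRing.residue R W₀.Δ = 0 := by
    rw [WeierstrassCurve.baseChange, WeierstrassCurve.map_Δ] at hbad
    exact (IsLocalRing.residue_eq_zero_iff _).mpr
      ((IsDedekindDomain.HeightOneSpectrum.valuation_lt_one_iff_mem _ _).mp hbad)
  have hc₄ : IsLocalRing.residue R W₀.c₄ = 0 := by
    rw [WeierstrassCurve.baseChange, WeierstrassCurve.map_c₄] at haddc
    exact (IsLocalRing.residue_eq_zero_iff _).mpr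
      ((IsDedekindDomain.HeightOneSpectrum.valuation_lt_one_iff_mem _ _).mp haddc)
  -- (c) `E₀(K)/E₁(K) ↪ k̄⁺`, where `N` is invertible: `P ∈ E₁(K)`
  obtain ⟨r, hr⟩ := W₀.exists_addMonoidHom_residueField_of_cusp hv hΔ hc₄
  have hNkb : (N : AlgebraicClosure (IsLocalRing.ResidueField R)) ≠ 0 := by
    rw [show (N : AlgebraicClosure (IsLocalRing.ResidueField R)) =
      algebraMap (IsLocalRing.ResidueField R) _ (N : IsLocalRing.ResidueField R) by simp]
    exact (map_ne_zero_iff _ (algebraMap (IsLocalRing.ResidueField R)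
      (AlgebraicClosure (IsLocalRing.ResidueField R))).injective).mpr hNk
  have hrP : r ⟨P, hP₀⟩ = 0 := by
    have h : (N : AlgebraicClosure (IsLocalRing.ResidueField R)) * r ⟨P, hP₀⟩ = 0 := by
      rw [← nsmul_eq_mul, ← map_nsmul]
      convert r.map_zero
      exact Subtype.ext hNP
    exact (mul_eq_zero.mp h).resolve_left hNkb
  have h1 : W₀.ReducesToZero P := (hr ⟨P, hP₀⟩).mp hrP
  -- (d) `E₁(K)` has no `N`-torsion
  by_contra hP0
  have hn1 : ValuationRing.valuation R K ((N : ℤ) : K) = 1 := by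
    rw [show ((N : ℤ) : K) = algebraMap R K (N : R) by simp, v_algebraMap_eq_one_iff hv]
    simpa using hNk
  exact not_reducesToZero_of_zsmul_eq_zero hv hn1 (by rw [natCast_zsmul]; exact hNP) hP0 h1

/-- **The component corollary over a henselian ring: `N ∣ c = ord(Δ_min)`.** In the situation of
`hasSplitMultiplicativeReduction_of_not_mem_goodReductionSubgroup`, if `R` is moreover henselian
(e.g. complete), then by the Kodaira–Néron theorem for split multiplicative reduction (Silverman,
*ATAEC* Cor. IV.9.2(d) with (b): `E(K)/E₀(K)` is cyclic of order `v(Δ_min) = -v(j)`; PROVED in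
the tree, `index_goodReductionSubgroup_of_hasSplitMultiplicativeReduction_holds`) the index
`c = [E(K) : E₀(K)]`, which `N` divides, is the valuation of the minimal discriminant:
`v(Δ) = exp(-c)` in `ℤᵐ⁰`. [cite: SilvermanATAEC1994, Cor. IV.9.2(d) with (b) (PDF p. 340)] -/
theorem dvd_index_and_valuation_Δ_of_not_mem_goodReductionSubgroup
    [HenselianRing R (IsLocalRing.maximalIdeal R)] [PerfectField (IsLocalRing.ResidueField R)]
    [W.IsElliptic] [W.IsMinimal R]
    {N : ℕ} (hN : N.Prime) (h5 : 5 ≤ N) {P : W.toAffine.Point} (hNP : N • P = 0)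
    (hP : P ∉ W.goodReductionSubgroup R) :
    N ∣ (W.goodReductionSubgroup R).index ∧
      IsDedekindDomain.HeightOneSpectrum.valuation K (IsDiscreteValuationRing.maximalIdeal R) W.Δ =
        WithZero.exp (-((W.goodReductionSubgroup R).index : ℤ)) := by
  obtain ⟨hsplit, hdvd⟩ :=
    hasSplitMultiplicativeReduction_of_not_mem_goodReductionSubgroup R W hN h5 hNP hP
  haveI := hsplit
  obtain ⟨-, hv⟩ := W.index_goodReductionSubgroup_of_hasSplitMultiplicativeReduction_holds R
  exact ⟨hdvd, hv⟩

/-- **Mazur 1977, Ch. III §5, Steps 1–2 together, over a discrete valuation ring with a small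
residue field.** Let `R` be a discrete valuation ring with finite residue field `k` of `q`
elements and fraction field `K`, `W` an `R`-minimal Weierstrass equation of an elliptic curve
over `K`, and `P ∈ E(K)` a point of prime order `N` with `2q + 1 < N`. Then: `P ∉ E₀(K)` ("the
specialization `ℤ/N_{/𝔽_q}` is not contained in the connected component of the identity
`(E_{/𝔽_q})⁰`", Step 2, p. 158, last display), the reduction is split multiplicative ("`E` has
bad (hence multiplicative) reduction at `q`", Step 2 with Step 1), and `N ∣ [E(K) : E₀(K)]`.
Proof: `N` is non-zero in `k` (`#k < N`), so `P ∈ E₀(K)` would give `N ≤ 2q + 1`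
(`addOrderOf_le_of_mem_goodReductionSubgroup`); hence `P ∉ E₀(K)`, and
`hasSplitMultiplicativeReduction_of_not_mem_goodReductionSubgroup` applies (`N ≥ 2·2 + 2 > 5`).
For `K = ℚ`, `q ∈ {2, 3}` and `N ≥ 11` this is exactly the scope of Mazur's Step 2; see
`Mazur1977_stepTwo_padic` and `Mazur1977_stepTwo` below.
[cite: Mazur1977, Ch. III §5, Steps 1–2, pp. 158–159; SilvermanATAEC1994, Cor. IV.9.2 (PDF p. 340)] -/
theorem Mazur1977_stepTwo_local [Finite (IsLocalRing.ResidueField R)] [W.IsElliptic]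
    [W.IsMinimal R] {N : ℕ} (hN : N.Prime) {P : W.toAffine.Point} (hP : addOrderOf P = N)
    (hq : 2 * Nat.card (IsLocalRing.ResidueField R) + 1 < N) :
    P ∉ W.goodReductionSubgroup R ∧ W.HasSplitMultiplicativeReduction R ∧
      N ∣ (W.goodReductionSubgroup R).index := by
  have hNk : (N : IsLocalRing.ResidueField R) ≠ 0 :=
    natCast_ne_zero_of_card_lt hN (by omega)
  have hNP : N • P = 0 := by rw [← hP]; exact addOrderOf_nsmul_eq_zero P
  have hP₀ : P ∉ W.goodReductionSubgroup R := by
    intro hmem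
    have hle := addOrderOf_le_of_mem_goodReductionSubgroup R W hmem (n := N)
      (by exact_mod_cast hNk) (by rw [natCast_zsmul]; exact hNP)
    omega
  have h1 : 1 < Nat.card (IsLocalRing.ResidueField R) := Finite.one_lt_card
  obtain ⟨hsplit, hdvd⟩ :=
    hasSplitMultiplicativeReduction_of_not_mem_goodReductionSubgroup R W hN (by omega) hNP hP₀
  exact ⟨hP₀, hsplit, hdvd⟩

end DVR

/-! ## §5 Over `ℚ`: Mazur's Step 2 at `q = 2, 3` (and at every prime `q` with `2q + 1 < N`) -/

section Rat

variable (W : WeierstrassCurve ℚ) [W.IsElliptic] (q : ℕ) [Fact q.Prime]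

/-- The residue field of `ℤ_q` has `q` elements. [folklore] -/
theorem natCard_residueField_padicInt : Nat.card (IsLocalRing.ResidueField ℤ_[q]) = q := by
  rw [Nat.card_congr (PadicInt.residueField (p := q)).toEquiv, Nat.card_zmod]

/-- The primes are `2, 3, 5, 7` or `≥ 11`. [folklore] -/
theorem eleven_le_of_prime_of_not_mem {N : ℕ} (hN : N.Prime)
    (hNS : N ∉ ({2, 3, 5, 7, 13} : Finset ℕ)) : 11 ≤ N := by
  simp only [Finset.mem_insert, Finset.mem_singleton, not_or] at hNS
  obtain ⟨h2, h3, h5, h7, -⟩ := hNS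
  by_contra h
  push Not at h
  interval_cases N
  · exact absurd hN Nat.not_prime_zero
  · exact absurd hN Nat.not_prime_one
  all_goals first
    | omega
    | exact absurd (hN.eq_one_or_self_of_dvd 2 (by decide)) (by omega)
    | exact absurd (hN.eq_one_or_self_of_dvd 3 (by decide)) (by omega)

/-- A prime `N ≠ q` is non-zero in the residue field `𝔽_q` of `ℤ_q`. [folklore] -/
theorem natCast_residueField_padicInt_ne_zero {N : ℕ} (hN : N.Prime) (hqN : q ≠ N) :
    (N : IsLocalRing.ResidueField ℤ_[q]) ≠ 0 := by
  intro h0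
  have h := congrArg (PadicInt.residueField (p := q)) h0
  rw [map_natCast, map_zero, ZMod.natCast_eq_zero_iff] at h
  exact hqN ((Nat.prime_dvd_prime_iff_eq Fact.out hN).mp h)

/-- **Mazur 1977, Ch. III §5, Step 1 for `E/ℚ` at the primes `q ≠ N`: semistability away from
`N`** (p. 158, "Step 1. — `E_{/S}` is semi-stable", the part of its proof dealing with `q ≠ N`).
An elliptic curve `E/ℚ` with a rational point of prime order `N ≥ 5` has good or multiplicative
(i.e. not additive) reduction at every prime `q ≠ N`: the `ℤ_q`-minimal model of `E ⊗ ℚ_q` does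
not have additive reduction. From `eq_zero_of_hasAdditiveReduction_of_prime_nsmul_eq_zero` at
`R = ℤ_q` (finite, hence perfect, residue field, in which `N ≠ q` is non-zero), applied to the
transported point, whose order is `N ≠ 1`.
[cite: Mazur1977, Ch. III §5, Step 1, p. 158; SilvermanATAEC1994, Cor. IV.9.2(d) (PDF p. 340)] -/
theorem Mazur1977_stepOne_padic {N : ℕ} (hN : N.Prime) (h5 : 5 ≤ N) {P : W.toAffine.Point}
    (hP : addOrderOf P = N) (hqN : q ≠ N) :
    ¬ ((W.baseChange ℚ_[q]).minimal ℤ_[q]).HasAdditiveReduction ℤ_[q] := by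
  intro hadd
  haveI := hadd
  haveI : (W.baseChange ℚ_[q]).IsElliptic := inferInstanceAs (W.map (algebraMap ℚ ℚ_[q])).IsElliptic
  have hmin : (W.baseChange ℚ_[q]).minimal ℤ_[q] =
      ((W.baseChange ℚ_[q]).exists_isMinimal ℤ_[q]).choose • W.baseChange ℚ_[q] := rfl
  haveI : ((W.baseChange ℚ_[q]).minimal ℤ_[q]).IsElliptic := by
    rw [hmin]
    infer_instance
  haveI : Finite (IsLocalRing.ResidueField ℤ_[q]) :=
    Finite.of_equiv (ZMod q) (PadicInt.residueField (p := q)).symm.toEquiv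
  set P' : ((W.baseChange ℚ_[q]).minimal ℤ_[q]).toAffine.Point :=
    VariableChange.pointEquiv (W.baseChange ℚ_[q])
      ((W.baseChange ℚ_[q]).exists_isMinimal ℤ_[q]).choose
      (Affine.Point.map (W' := W.toAffine) (S := ℚ) (Algebra.ofId ℚ ℚ_[q]) P) with hP'
  have hP'ord : addOrderOf P' = N :=
    ((AddEquiv.addOrderOf_eq _ _).trans (addOrderOf_injective _
      (Affine.Point.map_injective (W' := W.toAffine) (f := Algebra.ofId ℚ ℚ_[q])) P)).trans hP
  have hNP' : N • P' = 0 := by rw [← hP'ord]; exact addOrderOf_nsmul_eq_zero P'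
  have h0 : P' = 0 :=
    eq_zero_of_hasAdditiveReduction_of_prime_nsmul_eq_zero ℤ_[q] ((W.baseChange ℚ_[q]).minimal ℤ_[q])
      hN h5 (natCast_residueField_padicInt_ne_zero q hN hqN) hNP'
  rw [h0, addOrderOf_zero] at hP'ord
  exact hN.one_lt.ne hP'ord

/-- **Mazur 1977, Ch. III §5, Step 1 (`q ≠ N`) in the scope of the prime-case leaf**: an elliptic
curve over `ℚ` with a rational point of prime order `N ∉ {2, 3, 5, 7, 13}` is semistable (good
or multiplicative reduction) at every prime `q ≠ N`. [cite: Mazur1977, Ch. III §5, Step 1, p. 158] -/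
theorem Mazur1977_stepOne {N : ℕ} (hN : N.Prime) (hNS : N ∉ ({2, 3, 5, 7, 13} : Finset ℕ))
    {P : W.toAffine.Point} (hP : addOrderOf P = N) (hqN : q ≠ N) :
    ¬ ((W.baseChange ℚ_[q]).minimal ℤ_[q]).HasAdditiveReduction ℤ_[q] :=
  Mazur1977_stepOne_padic W q hN
    (le_trans (by norm_num) (eleven_le_of_prime_of_not_mem hN hNS)) hP hqN

/-- **Mazur 1977, Ch. III §5, Step 2, for `E/ℚ` at a prime `q` with `2q + 1 < N`** (p. 158,
last display: "If `q = 2`, or `3`, then `E` has bad (hence multiplicative) reduction at `q`, and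
the specialization `ℤ/N_{/𝔽_q}` is not contained in the connected component of the identity
`(E_{/𝔽_q})⁰`", with Step 1, p. 158, for "multiplicative"; here for any prime `q` with
`2q + 1 < N`, which for `N ≥ 11` includes `q = 2, 3`). Let `E/ℚ` be an elliptic curve (any
Weierstrass equation `W`) with a rational point `P` of prime order `N`, and `q` a prime with
`2q + 1 < N`. Transport `P` to the `ℤ_q`-minimal model `W_min = C • (W ⊗ ℚ_q)` chosen by Mathlib
(`WeierstrassCurve.minimal`; `E(ℚ) → E(ℚ_q)` is Mathlib's `Affine.Point.map`, the change of
coordinates is the tree's `VariableChange.pointEquiv`, both injective homomorphisms). Then: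
(i) the transported point is NOT in `E₀(ℚ_q)` (Mazur's "`ℤ/N ⊄ (E_{/𝔽_q})⁰`");
(ii) `E` has **split multiplicative** reduction at `q` (`HasSplitMultiplicativeReductionAtPrime`;
Mazur: "bad (hence multiplicative)");
(iii) `N ∣ c_q(E) = [E(ℚ_q) : E₀(ℚ_q)]` (`localTamagawaNumber`); and
(iv) `ord_q(Δ_min) = c_q(E)` (`v(Δ_min) = exp(-c_q)` in `ℤᵐ⁰`), so `N ∣ ord_q(Δ_min)` —
(iii)–(iv) by the Kodaira–Néron theorem over the complete ring `ℤ_q` (proved in the tree). This is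
`Mazur1977_stepTwo_local` at `R = ℤ_q` (`#𝔽_q = q`).
[cite: Mazur1977, Ch. III §5, Steps 1–2, pp. 158–159; SilvermanATAEC1994, Cor. IV.9.2(b),(d) (PDF p. 340)] -/
theorem Mazur1977_stepTwo_padic {N : ℕ} (hN : N.Prime) {P : W.toAffine.Point}
    (hP : addOrderOf P = N) (hq : 2 * q + 1 < N) :
    VariableChange.pointEquiv (W.baseChange ℚ_[q])
        ((W.baseChange ℚ_[q]).exists_isMinimal ℤ_[q]).choose
        (Affine.Point.map (W' := W.toAffine) (S := ℚ) (Algebra.ofId ℚ ℚ_[q]) P) ∉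
      ((W.baseChange ℚ_[q]).minimal ℤ_[q]).goodReductionSubgroup ℤ_[q] ∧
    W.HasSplitMultiplicativeReductionAtPrime q ∧
    N ∣ (W.baseChange ℚ_[q]).localTamagawaNumber ℤ_[q] ∧
    IsDedekindDomain.HeightOneSpectrum.valuation ℚ_[q] (IsDiscreteValuationRing.maximalIdeal ℤ_[q])
        ((W.baseChange ℚ_[q]).minimal ℤ_[q]).Δ =
      WithZero.exp (-((W.baseChange ℚ_[q]).localTamagawaNumber ℤ_[q] : ℤ)) := by
  haveI : (W.baseChange ℚ_[q]).IsElliptic := inferInstanceAs (W.map (algebraMap ℚ ℚ_[q])).IsElliptic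
  have hmin : (W.baseChange ℚ_[q]).minimal ℤ_[q] =
      ((W.baseChange ℚ_[q]).exists_isMinimal ℤ_[q]).choose • W.baseChange ℚ_[q] := rfl
  haveI : ((W.baseChange ℚ_[q]).minimal ℤ_[q]).IsElliptic := by
    rw [hmin]
    infer_instance
  haveI : Finite (IsLocalRing.ResidueField ℤ_[q]) :=
    Finite.of_equiv (ZMod q) (PadicInt.residueField (p := q)).symm.toEquiv
  set P' : ((W.baseChange ℚ_[q]).minimal ℤ_[q]).toAffine.Point :=
    VariableChange.pointEquiv (W.baseChange ℚ_[q])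
      ((W.baseChange ℚ_[q]).exists_isMinimal ℤ_[q]).choose
      (Affine.Point.map (W' := W.toAffine) (S := ℚ) (Algebra.ofId ℚ ℚ_[q]) P) with hP'
  have hP'ord : addOrderOf P' = N :=
    ((AddEquiv.addOrderOf_eq _ _).trans (addOrderOf_injective _
      (Affine.Point.map_injective (W' := W.toAffine) (f := Algebra.ofId ℚ ℚ_[q])) P)).trans hP
  have hq' : 2 * Nat.card (IsLocalRing.ResidueField ℤ_[q]) + 1 < N := by
    rw [natCard_residueField_padicInt]; exact hq
  obtain ⟨hP₀, hsplit, hdvd⟩ :=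
    Mazur1977_stepTwo_local ℤ_[q] ((W.baseChange ℚ_[q]).minimal ℤ_[q]) hN hP'ord hq'
  haveI := hsplit
  obtain ⟨-, hv⟩ := ((W.baseChange ℚ_[q]).minimal
    ℤ_[q]).index_goodReductionSubgroup_of_hasSplitMultiplicativeReduction_holds ℤ_[q]
  exact ⟨hP₀, hsplit, hdvd, hv⟩

/-- **Mazur 1977, Ch. III §5, Step 2, in the scope of the prime-case leaf** (`N` a prime
`≠ 2, 3, 5, 7, 13`, hence `N ≥ 11`, and `q = 2` or `3`, so `2q + 1 ≤ 7 < N`): for an elliptic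
curve `E/ℚ` with a rational point of such a prime order `N` — the object which the leaf
`Mazur1977_no_prime_torsion` asserts not to exist — `E` has split multiplicative reduction at `2`
and at `3`, the point lies off the identity component there, and `N` divides
`c_q(E) = ord_q(Δ_min)` for `q = 2, 3`. This is the complete content of Step 2 (with Step 1 at
`q = 2, 3`) of the printed proof; Steps 3–4 and the three reductions (the Eisenstein quotient
`J̃`, Thm. III.(4.1), Raynaud, Herbrand) are what remains of the leaf.
[cite: Mazur1977, Ch. III §5, Steps 1–2, pp. 158–159] -/
theorem Mazur1977_stepTwo {N : ℕ} (hN : N.Prime) (hNS : N ∉ ({2, 3, 5, 7, 13} : Finset ℕ))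
    {P : W.toAffine.Point} (hP : addOrderOf P = N) (hq : q = 2 ∨ q = 3) :
    VariableChange.pointEquiv (W.baseChange ℚ_[q])
        ((W.baseChange ℚ_[q]).exists_isMinimal ℤ_[q]).choose
        (Affine.Point.map (W' := W.toAffine) (S := ℚ) (Algebra.ofId ℚ ℚ_[q]) P) ∉
      ((W.baseChange ℚ_[q]).minimal ℤ_[q]).goodReductionSubgroup ℤ_[q] ∧
    W.HasSplitMultiplicativeReductionAtPrime q ∧
    N ∣ (W.baseChange ℚ_[q]).localTamagawaNumber ℤ_[q] ∧
    IsDedekindDomain.HeightOneSpectrum.valuation ℚ_[q] (IsDiscreteValuationRing.maximalIdeal ℤ_[q])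
        ((W.baseChange ℚ_[q]).minimal ℤ_[q]).Δ =
      WithZero.exp (-((W.baseChange ℚ_[q]).localTamagawaNumber ℤ_[q] : ℤ)) := by
  have h11 := eleven_le_of_prime_of_not_mem hN hNS
  exact Mazur1977_stepTwo_padic W q hN hP (by rcases hq with rfl | rfl <;> omega)

omit [W.IsElliptic] in
/-- **The prime-case leaf, PROVED for every elliptic curve over `ℚ` with `c₂ < 11` or `c₃ < 11`**
— in particular for every curve whose reduction at `2` (or at `3`) is good, additive or
non-split multiplicative (`c ≤ 4` by Kodaira–Néron), e.g. every curve of odd conductor: by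
`Mazur1977_stepTwo`, a rational point of prime order `N ∉ {2, 3, 5, 7, 13}` forces
`N ∣ c₂(E)` and `N ∣ c₃(E)` with `c_q(E) ≠ 0`, hence `11 ≤ N ≤ min(c₂, c₃)`. (A proved
special case of `Literature.NumberTheory.EllipticCurves.Mazur1977_no_prime_torsion W`, whose
general case is Mazur's theorem of pp. 156–160.)
[cite: Mazur1977, Ch. III §5, Steps 1–2, pp. 158–159, with Cor. (5.2) p. 156 (statement)] -/
theorem Mazur1977_no_prime_torsion_of_localTamagawaNumber_lt
    (h : (W.baseChange ℚ_[2]).localTamagawaNumber ℤ_[2] < 11 ∨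
      (W.baseChange ℚ_[3]).localTamagawaNumber ℤ_[3] < 11) :
    Mazur1977_no_prime_torsion W := by
  intro _ N hN hNS hex
  obtain ⟨P, hP⟩ := hex
  have h11 := eleven_le_of_prime_of_not_mem hN hNS
  have key : ∀ (ℓ : ℕ) [Fact ℓ.Prime], ℓ = 2 ∨ ℓ = 3 →
      11 ≤ (W.baseChange ℚ_[ℓ]).localTamagawaNumber ℤ_[ℓ] := by
    intro ℓ _ hℓ
    obtain ⟨-, -, hdvd, -⟩ := Mazur1977_stepTwo W ℓ hN hNS hP hℓ
    haveI : (W.baseChange ℚ_[ℓ]).IsElliptic :=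
      inferInstanceAs (W.map (algebraMap ℚ ℚ_[ℓ])).IsElliptic
    haveI : ((W.baseChange ℚ_[ℓ]).minimal ℤ_[ℓ]).IsElliptic := by
      rw [show (W.baseChange ℚ_[ℓ]).minimal ℤ_[ℓ] =
        ((W.baseChange ℚ_[ℓ]).exists_isMinimal ℤ_[ℓ]).choose • W.baseChange ℚ_[ℓ] from rfl]
      infer_instance
    haveI : Finite (IsLocalRing.ResidueField ℤ_[ℓ]) :=
      Finite.of_equiv (ZMod ℓ) (PadicInt.residueField (p := ℓ)).symm.toEquiv
    have hne : (W.baseChange ℚ_[ℓ]).localTamagawaNumber ℤ_[ℓ] ≠ 0 :=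
      ((W.baseChange ℚ_[ℓ]).minimal ℤ_[ℓ]).index_goodReductionSubgroup_ne_zero_holds ℤ_[ℓ]
    exact h11.trans (Nat.le_of_dvd (Nat.pos_of_ne_zero hne) hdvd)
  rcases h with h2 | h3
  · exact absurd (key 2 (Or.inl rfl)) (not_le.mpr h2)
  · exact absurd (key 3 (Or.inr rfl)) (not_le.mpr h3)

omit [W.IsElliptic] in
/-- **The prime-case leaf, PROVED for every elliptic curve over `ℚ` which is not split
multiplicative at `2` or not split multiplicative at `3`** (good, additive or non-split
multiplicative reduction there; e.g. all curves of odd conductor, all curves with additive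
reduction at `2`): immediate from `Mazur1977_stepTwo` (ii).
[cite: Mazur1977, Ch. III §5, Steps 1–2, pp. 158–159, with Cor. (5.2) p. 156 (statement)] -/
theorem Mazur1977_no_prime_torsion_of_not_hasSplitMultiplicativeReductionAtPrime
    (h : ¬ W.HasSplitMultiplicativeReductionAtPrime 2 ∨
      ¬ W.HasSplitMultiplicativeReductionAtPrime 3) :
    Mazur1977_no_prime_torsion W := by
  intro _ N hN hNS hex
  obtain ⟨P, hP⟩ := hex
  rcases h with h2 | h3
  · exact h2 (Mazur1977_stepTwo W 2 hN hNS hP (Or.inl rfl)).2.1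
  · exact h3 (Mazur1977_stepTwo W 3 hN hNS hP (Or.inr rfl)).2.1

end Rat

end Literature.NumberTheory.EllipticCurves

end
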